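import Mathlib
import Literature.Computability.AlgebraicComplexity.Hyperdeterminant
import Summits.ValiantsHypothesis.ValiantsHypothesis.Theorems.BorderApolarityBorelFixedBorderApolarity
import Summits.ValiantsHypothesis.ValiantsHypothesis.Theorems.DetQPDetqpThesisBorelFixedDescent

/-!
# `DetqpThesis` (stmt-ValiantsHypothesis-0315), line `four-dimensional-determinant` — stub B2d:
# Borel-fixed border-apolar witnesses for the padded four-dimensional determinant, from the parts

Crux `DetQP.DetqpThesis` (stmt-ValiantsHypothesis-0315), registered stub `stub_borelFixed_of_parts`.

`pp := X₀₀^{m-n} · H_n(X_ι)` is the padded four-dimensional determinant placed by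
`ι : (Fin 4 → Fin n) → Fin m × Fin m` among the `m²` matrix variables; `H(n,m,ι)` is the group of
substitutions `M` (column `i` = image of `X i`) whose used block is the Kronecker product of four
upper triangular `a_r` (`M (ι I') (ι I) = ∏_r a_r (I'_r) (I_r)`), whose used columns have no other
entries, whose padding column is a scalar and whose unused columns are triangular for
`p ↦ p.1 * m + p.2` (character `M₀₀^{m-n} ∏_r ∏_i a_r(i,i) = 1`).  From (B2w) a generic
anti-dominant weight `μ`, (B2s) `H(n,m,ι) ⊆ Stab(pp)`, (B2t) the torus-limit operation on the set
`Y` of degree-wise Kuratowski limits `J = lim Ann(P_t)` (`P_t ∈ GL · det_m`) inside `Ann(pp)`, and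
a point of `Y`, we produce a point of `Y` stable under `D ↦ Mᵀ · D` for all invertible `M ∈ H`:
(1) the torus limit of the given point is `μ`-graded; (2) DESCENT (`hdbf_descent`, the target-free
form of the route's `bfba_descent`) over the unipotent class `U = {V : V unit diagonal, Vᵀ ∈ H}` —
its elements lower `μ` (`bfH_dir`), have determinant one (`bfH_det_unipotent`) and their
contragredients `(V⁻¹)ᵀ = (Vᵀ)⁻¹` fix `pp` (B2s); (3) W4 (`bfH_W4`): `Mᵀ = V · diag(M)` with
`V ∈ U`, and `diag(M)` preserves graded `J_k` by genericity (`bfH_torus_stable`).  The per-analogue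
is the landed route file `Theorems/BorderApolarityBorelFixedBorderApolarity.lean` (item 5781), from
whose `Lowering` companion the helper proofs are adapted.

References: A. Borel, *Linear Algebraic Groups* (1991), Thm 10.4 [Borel1991]; W. Buczyńska,
J. Buczyński, Duke Math. J. 170 (2021), Thm 31 [BuczynskaBuczynski2021]; A. Conner, A. Harper,
J. M. Landsberg, Forum Math. Pi 11 (2023), §2.4 [ConnerHarperLandsberg2023].  Folklore otherwise.
-/

noncomputable section

-- single-conjunct layout: Sub = Summit, duplicated namespace component intended
set_option linter.dupNamespace false

namespace Summit.ValiantsHypothesis.ValiantsHypothesis.Theorems.DetQPDetqpThesis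

open Literature.Computability.AlgebraicComplexity MvPolynomial Filter
open scoped BigOperators Topology Matrix
open Summit.ValiantsHypothesis.ValiantsHypothesis.Theorems.BorderApolarityBorelFixedBorderApolarity
open Summit.ValiantsHypothesis.ValiantsHypothesis.Theorems.BorderApolarityToricFixedPoints
open Summit.ValiantsHypothesis.ValiantsHypothesis.Theorems.DetQPDetqpThesis.HdBorelFixed

/-! ## Directions of the moves of `H(n,m,ι)` -/

/-- **Off-diagonal entries of `H(n,m,ι)` lower the weight.**  Let `M` have the Kronecker used
block for upper triangular `a_r` (`hK`, `hup`), used columns without unused entries (`h2`), a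
scalar padding column (`h3`) and unused columns triangular for `p ↦ p.1 * m + p.2` (`h4`), and let
`μ` be anti-dominant (`hAD1`–`hAD4`).  Then `M i j ≠ 0`, `i ≠ j` forces `μ j < μ i`. [folklore] -/
theorem bfH_dir {n m : ℕ} [NeZero m] (ι : (Fin 4 → Fin n) → Fin m × Fin m)
    (μ : Fin m × Fin m → ℤ)
    (hAD1 : ∀ I I' : Fin 4 → Fin n, (∀ r, I' r ≤ I r) → I ≠ I' → μ (ι I) < μ (ι I'))
    (hAD2 : ∀ p : Fin m × Fin m, p ∉ Set.range ι → p ≠ (0, 0) → ∀ I : Fin 4 → Fin n, μ p < μ (ι I))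
    (hAD3 : ∀ p : Fin m × Fin m, p ∉ Set.range ι → p ≠ (0, 0) → μ p < μ (0, 0))
    (hAD4 : ∀ p q : Fin m × Fin m, p ∉ Set.range ι → p ≠ (0, 0) → q ∉ Set.range ι → q ≠ (0, 0) →
      (p.1 : ℕ) * m + (p.2 : ℕ) < (q.1 : ℕ) * m + (q.2 : ℕ) → μ q < μ p)
    (M : Matrix (Fin m × Fin m) (Fin m × Fin m) ℂ) (a : Fin 4 → Matrix (Fin n) (Fin n) ℂ)
    (hup : ∀ (r : Fin 4) (i j : Fin n), j < i → a r i j = 0)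
    (hK : ∀ I I' : Fin 4 → Fin n, M (ι I') (ι I) = ∏ r, a r (I' r) (I r))
    (h2 : ∀ (I : Fin 4 → Fin n) (p : Fin m × Fin m), p ∉ Set.range ι → M p (ι I) = 0)
    (h3 : ∀ p : Fin m × Fin m, p ≠ (0, 0) → M p (0, 0) = 0)
    (h4 : ∀ p q : Fin m × Fin m, p ∉ Set.range ι → p ≠ (0, 0) → q ∉ Set.range ι → q ≠ (0, 0) →
      (p.1 : ℕ) * m + (p.2 : ℕ) < (q.1 : ℕ) * m + (q.2 : ℕ) → M q p = 0) :
    ∀ i j : Fin m × Fin m, i ≠ j → M i j ≠ 0 → μ j < μ i := by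
  intro i j hij hM
  by_cases hj : j ∈ Set.range ι
  · obtain ⟨I, rfl⟩ := hj
    by_cases hi : i ∈ Set.range ι
    · obtain ⟨I', rfl⟩ := hi
      rw [hK] at hM
      refine hAD1 I I' (fun r => ?_) fun h => hij (congrArg ι h).symm
      by_contra hlt
      exact Finset.prod_ne_zero_iff.1 hM r (Finset.mem_univ r) (hup r _ _ (not_le.1 hlt))
    · exact absurd (h2 I i hi) hM
  by_cases hj0 : j = (0, 0)
  · rw [hj0] at hM hij
    exact absurd (h3 i hij) hM
  by_cases hi : i ∈ Set.range ι
  · obtain ⟨I, rfl⟩ := hi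
    exact hAD2 j hj hj0 I
  by_cases hi0 : i = (0, 0)
  · rw [hi0]
    exact hAD3 j hj hj0
  have hne : (i.1 : ℕ) * m + (i.2 : ℕ) ≠ (j.1 : ℕ) * m + (j.2 : ℕ) := fun h =>
    hij (bfba_lin_injective i j h)
  rcases lt_or_gt_of_ne hne with hlt | hlt
  · exact hAD4 i j hi hi0 hj hj0 hlt
  · exact absurd (h4 j i hj hj0 hi hi0 hlt) hM

/-! ## Triangularity for the injective grading `μ` -/

/-- A unit-diagonal matrix whose off-diagonal entries `V a b ≠ 0` satisfy `μ a < μ b`, for an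
injective grading `μ`, has determinant one (`det = ∏ diagonal`, `bfba_det_eq_prod_diag`).
[folklore] -/
theorem bfH_det_unipotent {σ : Type} [Fintype σ] [DecidableEq σ] (μ : σ → ℤ)
    (hμinj : Function.Injective μ) (V : Matrix σ σ ℂ) (hV1 : ∀ a, V a a = 1)
    (hVμ : ∀ a b, a ≠ b → V a b ≠ 0 → μ a < μ b) : V.det = 1 := by
  have htri : V.BlockTriangular μ := by
    intro i j hij
    by_contra h
    have hne : i ≠ j := fun heq => by subst heq; exact lt_irrefl _ hij
    exact lt_asymm hij (hVμ i j hne h)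
  rw [bfba_det_eq_prod_diag μ hμinj V htri]
  exact Finset.prod_eq_one fun a _ => hV1 a

/-- An invertible matrix whose off-diagonal entries `M i j ≠ 0` satisfy `μ j < μ i`, for an
injective grading `μ`, has nowhere-zero diagonal (`det = ∏ diagonal`). [folklore] -/
theorem bfH_diag_ne_zero {σ : Type} [Fintype σ] [DecidableEq σ] (μ : σ → ℤ)
    (hμinj : Function.Injective μ) (M : Matrix σ σ ℂ) (hM : IsUnit M.det)
    (hdir : ∀ i j, i ≠ j → M i j ≠ 0 → μ j < μ i) : ∀ a, M a a ≠ 0 := by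
  have htri : M.BlockTriangular (OrderDual.toDual ∘ μ) := by
    intro i j hij
    by_contra h
    have hij' : μ i < μ j := OrderDual.toDual_lt_toDual.1 hij
    have hne : i ≠ j := fun heq => by subst heq; exact lt_irrefl _ hij'
    exact lt_asymm hij' (hdir i j hne h)
  have h := hM.ne_zero
  rw [bfba_det_eq_prod_diag _ (OrderDual.toDual.injective.comp hμinj) M htri,
    Finset.prod_ne_zero_iff] at h
  exact fun a => h a (Finset.mem_univ a)

/-! ## Graded subspaces are stable under the diagonal part of `H(n,m,ι)` -/

/-- **Torus stability of graded subspaces.**  If `μ` has the genericity property (clause 4 of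
stub B2w: equal `μ`-weight in degree `≤ m` forces equal character for every nowhere-zero `d` of
`H`-diagonal shape `d (ι I) = ∏_r t_r (I_r)`), then a `μ`-graded subspace `L` of degree-`k` forms,
`k ≤ m`, is stable under `diag(d)` for every such `d`: on a weight component all monomials have
the same character, so `diag(d)` acts on it by a scalar. [folklore] -/
theorem bfH_torus_stable {n m : ℕ} (ι : (Fin 4 → Fin n) → Fin m × Fin m) (μ : Fin m × Fin m → ℤ)
    (hμ4 : ∀ e e' : Fin m × Fin m →₀ ℕ, e.degree ≤ m → e'.degree ≤ m →
        Finsupp.weight μ e = Finsupp.weight μ e' →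
        ∀ d : Fin m × Fin m → ℂ, (∀ v, d v ≠ 0) →
          (∃ t : Fin 4 → Fin n → ℂ, ∀ I : Fin 4 → Fin n, d (ι I) = ∏ r, t r (I r)) →
          ∏ v ∈ e.support, d v ^ e v = ∏ v ∈ e'.support, d v ^ e' v)
    (k : ℕ) (hk : k ≤ m) (L : Submodule ℂ (MvPolynomial (Fin m × Fin m) ℂ))
    (hL : L ≤ homogeneousSubmodule (Fin m × Fin m) ℂ k)
    (hgr : ∀ D ∈ L, ∀ ν : ℤ, weightedHomogeneousComponent μ ν D ∈ L)
    (d : Fin m × Fin m → ℂ) (hd : ∀ v, d v ≠ 0)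
    (hpat : ∃ t : Fin 4 → Fin n → ℂ, ∀ I : Fin 4 → Fin n, d (ι I) = ∏ r, t r (I r)) :
    ∀ D ∈ L, linSubst (Fin m × Fin m) ℂ (Matrix.diagonal d) D ∈ L := by
  classical
  intro D hD
  rw [← cr_sum_comp (μ := μ) D, map_sum]
  refine L.sum_mem fun ν' _ => ?_
  set G := weightedHomogeneousComponent μ ν' D with hG
  have hGL : G ∈ L := hgr D hD ν'
  have hGhom : G.IsHomogeneous k := (mem_homogeneousSubmodule k G).1 (hL hGL)
  have hGwt : ∀ e ∈ G.support, Finsupp.weight μ e = ν' := by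
    intro e he
    rw [mem_support_iff, hG, coeff_weightedHomogeneousComponent] at he
    by_contra h
    exact he (if_neg h)
  have hGdeg : ∀ e ∈ G.support, e.degree = k := by
    intro e he
    rw [Finsupp.degree_eq_weight_one]
    exact hGhom (mem_support_iff.1 he)
  by_cases hG0 : G = 0
  · rw [hG0, map_zero]; exact L.zero_mem
  obtain ⟨e₀, he₀⟩ := Finset.nonempty_of_ne_empty (mt support_eq_empty.1 hG0)
  set χ : ℂ := ∏ v ∈ e₀.support, d v ^ e₀ v with hχ
  have hscal : linSubst (Fin m × Fin m) ℂ (Matrix.diagonal d) G = χ • G := by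
    ext e
    rw [tli_coeff_linSubst_diagonal, coeff_smul, smul_eq_mul]
    by_cases he : e ∈ G.support
    · rw [hμ4 e e₀ ((hGdeg e he).le.trans hk) ((hGdeg e₀ he₀).le.trans hk)
        ((hGwt e he).trans (hGwt e₀ he₀).symm) d hd hpat]
    · rw [notMem_support_iff.1 he, mul_zero, mul_zero]
  rw [hscal]
  exact L.smul_mem χ hGL

/-! ## W4 from gradedness and unipotent stability -/

/-- **Stability under `H(n,m,ι)` from torus and unipotent stability.**  Let the `J k`, `k ≤ m`, be
`μ`-graded subspaces of degree-`k` forms (`μ` injective, anti-dominant and generic as in stub B2w),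
stable under every `V` of the unipotent class (`V` unit diagonal, `Vᵀ ∈ H(n,m,ι)`).  Then every
invertible `M ∈ H(n,m,ι)` maps each `J k` into itself by `D ↦ Mᵀ · D`: the diagonal of `M` is
nowhere zero (`bfH_diag_ne_zero`), `Mᵀ = V · diag(M)` with `V := (diag(M)⁻¹ · M)ᵀ` in the class
(the used block of `diag(M)⁻¹ · M` is the Kronecker product of the `diag(a_r)⁻¹ · a_r`),
`diag(M)` preserves `J k` by `bfH_torus_stable`, and `V` by assumption.  Analogue of
`bfba_W4_of_graded_of_unipotent`. [folklore] -/
theorem bfH_W4 (n m : ℕ) [NeZero m] (ι : (Fin 4 → Fin n) → Fin m × Fin m)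
    (μ : Fin m × Fin m → ℤ) (hμinj : Function.Injective μ)
    (hAD1 : ∀ I I' : Fin 4 → Fin n, (∀ r, I' r ≤ I r) → I ≠ I' → μ (ι I) < μ (ι I'))
    (hAD2 : ∀ p : Fin m × Fin m, p ∉ Set.range ι → p ≠ (0, 0) → ∀ I : Fin 4 → Fin n, μ p < μ (ι I))
    (hAD3 : ∀ p : Fin m × Fin m, p ∉ Set.range ι → p ≠ (0, 0) → μ p < μ (0, 0))
    (hAD4 : ∀ p q : Fin m × Fin m, p ∉ Set.range ι → p ≠ (0, 0) → q ∉ Set.range ι → q ≠ (0, 0) →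
      (p.1 : ℕ) * m + (p.2 : ℕ) < (q.1 : ℕ) * m + (q.2 : ℕ) → μ q < μ p)
    (hμ4 : ∀ e e' : Fin m × Fin m →₀ ℕ, e.degree ≤ m → e'.degree ≤ m →
        Finsupp.weight μ e = Finsupp.weight μ e' →
        ∀ d : Fin m × Fin m → ℂ, (∀ v, d v ≠ 0) →
          (∃ t : Fin 4 → Fin n → ℂ, ∀ I : Fin 4 → Fin n, d (ι I) = ∏ r, t r (I r)) →
          ∏ v ∈ e.support, d v ^ e v = ∏ v ∈ e'.support, d v ^ e' v)
    (J : ℕ → Set (MvPolynomial (Fin m × Fin m) ℂ))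
    (hJsub : ∀ k ≤ m, ∃ Lk : Submodule ℂ (MvPolynomial (Fin m × Fin m) ℂ),
      (Lk : Set (MvPolynomial (Fin m × Fin m) ℂ)) = J k ∧
        Lk ≤ homogeneousSubmodule (Fin m × Fin m) ℂ k)
    (hgr : ∀ k ≤ m, ∀ D ∈ J k, ∀ ν : ℤ, weightedHomogeneousComponent μ ν D ∈ J k)
    (hU : ∀ V : Matrix (Fin m × Fin m) (Fin m × Fin m) ℂ,
      ((∀ a, V a a = 1) ∧
        (∃ a : Fin 4 → Matrix (Fin n) (Fin n) ℂ,
          (∀ (r : Fin 4) (i j : Fin n), j < i → a r i j = 0) ∧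
          (∀ I I' : Fin 4 → Fin n, Vᵀ (ι I') (ι I) = ∏ r, a r (I' r) (I r)) ∧
          Vᵀ (0, 0) (0, 0) ^ (m - n) * ∏ r, ∏ i, a r i i = 1) ∧
        (∀ (I : Fin 4 → Fin n) (p : Fin m × Fin m), p ∉ Set.range ι → Vᵀ p (ι I) = 0) ∧
        (∀ p : Fin m × Fin m, p ≠ (0, 0) → Vᵀ p (0, 0) = 0) ∧
        (∀ p q : Fin m × Fin m, p ∉ Set.range ι → p ≠ (0, 0) → q ∉ Set.range ι → q ≠ (0, 0) →
          (p.1 : ℕ) * m + (p.2 : ℕ) < (q.1 : ℕ) * m + (q.2 : ℕ) → Vᵀ q p = 0)) →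
      ∀ k ≤ m, ∀ D ∈ J k, linSubst (Fin m × Fin m) ℂ V D ∈ J k)
    (M : Matrix (Fin m × Fin m) (Fin m × Fin m) ℂ) (hM : IsUnit M.det)
    (ha : ∃ a : Fin 4 → Matrix (Fin n) (Fin n) ℂ,
        (∀ (r : Fin 4) (i j : Fin n), j < i → a r i j = 0) ∧
        (∀ I I' : Fin 4 → Fin n, M (ι I') (ι I) = ∏ r, a r (I' r) (I r)) ∧
        M (0, 0) (0, 0) ^ (m - n) * ∏ r, ∏ i, a r i i = 1)
    (hb : ∀ (I : Fin 4 → Fin n) (p : Fin m × Fin m), p ∉ Set.range ι → M p (ι I) = 0)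
    (hc : ∀ p : Fin m × Fin m, p ≠ (0, 0) → M p (0, 0) = 0)
    (hd : ∀ p q : Fin m × Fin m, p ∉ Set.range ι → p ≠ (0, 0) → q ∉ Set.range ι → q ≠ (0, 0) →
        (p.1 : ℕ) * m + (p.2 : ℕ) < (q.1 : ℕ) * m + (q.2 : ℕ) → M q p = 0) :
    ∀ k ≤ m, ∀ D ∈ J k, linSubst (Fin m × Fin m) ℂ Mᵀ D ∈ J k := by
  classical
  intro k hk D hD
  obtain ⟨a, hup, hK, -⟩ := ha
  have hdiag : ∀ v, M v v ≠ 0 :=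
    bfH_diag_ne_zero μ hμinj M hM (bfH_dir ι μ hAD1 hAD2 hAD3 hAD4 M a hup hK hb hc hd)
  have hadiag : ∀ r i, a r i i ≠ 0 := by
    intro r i
    have h := hdiag (ι fun _ => i)
    rw [hK] at h
    exact Finset.prod_ne_zero_iff.1 h r (Finset.mem_univ r)
  -- `Mᵀ = V · diag(M)`
  set V : Matrix (Fin m × Fin m) (Fin m × Fin m) ℂ := fun x y => M y x / M y y with hV
  have hV1 : ∀ x, V x x = 1 := fun x => div_self (hdiag x)
  have hVt : ∀ x y, Vᵀ x y = M x y / M x x := fun x y => rfl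
  have hMt : Mᵀ = V * Matrix.diagonal fun v => M v v := by
    ext x y
    rw [Matrix.mul_diagonal, Matrix.transpose_apply]
    simp only [hV]
    rw [div_mul_cancel₀ _ (hdiag y)]
  rw [hMt, linSubst_mul, AlgHom.comp_apply]
  refine hU V ⟨hV1, ⟨fun r i j => a r i j / a r i i, ?_, ?_, ?_⟩, ?_, ?_, ?_⟩ k hk _ ?_
  · intro r i j hji
    show a r i j / a r i i = 0
    rw [hup r i j hji, zero_div]
  · intro I I'
    show Vᵀ (ι I') (ι I) = ∏ r, a r (I' r) (I r) / a r (I' r) (I' r)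
    rw [hVt, hK, hK, Finset.prod_div_distrib]
  · show Vᵀ (0, 0) (0, 0) ^ (m - n) * ∏ r, ∏ i, a r i i / a r i i = 1
    rw [hVt, div_self (hdiag _), one_pow, one_mul]
    exact Finset.prod_eq_one fun r _ => Finset.prod_eq_one fun i _ => div_self (hadiag r i)
  · intro I p hp
    rw [hVt, hb I p hp, zero_div]
  · intro p hp
    rw [hVt, hc p hp, zero_div]
  · intro p q hp hp0 hq hq0 hlt
    rw [hVt, hd p q hp hp0 hq hq0 hlt, zero_div]
  · obtain ⟨Lk, hLk, hLkle⟩ := hJsub k hk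
    have hmem : ∀ E, E ∈ Lk ↔ E ∈ J k := fun E => by rw [← SetLike.mem_coe, hLk]
    rw [← hmem]
    exact bfH_torus_stable ι μ hμ4 k hk Lk hLkle
      (fun E hE ν => (hmem _).2 (hgr k hk E ((hmem E).1 hE) ν)) (fun v => M v v) hdiag
      ⟨fun r i => a r i i, fun I => hK I I⟩ D ((hmem D).2 hD)

/-! ## The stub -/

/-- **Stub B2d — Borel-fixed witnesses from the parts: weights (B2w) + stabiliser (B2s) + torus
limit (B2t) ⇒ B2.**  Given a witness `(P, J)` for `pp := X₀₀^{m-n} H_n(X_ι)` (orbit sequence,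
`IsBorderApolarLimit`, `J ⊆ Ann(pp)`), there is one whose `J` is moreover stable under
`D ↦ Mᵀ · D` for every invertible `M ∈ H(n,m,ι)`.  Proof: take `μ` from B2w; the torus limit
(B2t) gives a `μ`-graded witness; the descent `hdbf_descent` over the unipotent class
`{V : V unit diagonal, Vᵀ ∈ H(n,m,ι)}` (lowering by `bfH_dir`, unimodular by
`bfH_det_unipotent`, contragredient fixing `pp` by B2s) gives a graded witness stable under the class;
W4 by `bfH_W4`.  [Borel1991 Thm 10.4 replaced by explicit descent; BuczynskaBuczynski2021 Thm 31;
ConnerHarperLandsberg2023 §2.4] -/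
theorem stub_borelFixed_of_parts (n m : ℕ) [NeZero m] (_hn : 1 ≤ n) (_hnm : n ≤ m)
    (ι : (Fin 4 → Fin n) → Fin m × Fin m) (_hι : Function.Injective ι)
    (_hℓ : ((0 : Fin m), (0 : Fin m)) ∉ Set.range ι)
    -- B2w
    (hW : ∃ μ : Fin m × Fin m → ℤ,
      (∀ v, 0 ≤ μ v) ∧
      Function.Injective μ ∧
      (∀ I I' : Fin 4 → Fin n, (∀ r, I' r ≤ I r) → I ≠ I' → μ (ι I) < μ (ι I')) ∧
      (∀ p : Fin m × Fin m, p ∉ Set.range ι → p ≠ (0, 0) → ∀ I : Fin 4 → Fin n, μ p < μ (ι I)) ∧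
      (∀ p : Fin m × Fin m, p ∉ Set.range ι → p ≠ (0, 0) → μ p < μ (0, 0)) ∧
      (∀ p q : Fin m × Fin m, p ∉ Set.range ι → p ≠ (0, 0) → q ∉ Set.range ι → q ≠ (0, 0) →
        (p.1 : ℕ) * m + (p.2 : ℕ) < (q.1 : ℕ) * m + (q.2 : ℕ) → μ q < μ p) ∧
      (∃ ν₀, ∀ d ∈ (X ((0 : Fin m), (0 : Fin m)) ^ (m - n) *
          rename ι (hyperdet fun I : Fin 4 → Fin n => (X I : MvPolynomial (Fin 4 → Fin n) ℂ))).support,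
        Finsupp.weight μ d = ν₀) ∧
      (∀ e e' : Fin m × Fin m →₀ ℕ, e.degree ≤ m → e'.degree ≤ m →
        Finsupp.weight μ e = Finsupp.weight μ e' →
        ∀ d : Fin m × Fin m → ℂ, (∀ v, d v ≠ 0) →
          (∃ t : Fin 4 → Fin n → ℂ, ∀ I : Fin 4 → Fin n, d (ι I) = ∏ r, t r (I r)) →
          ∏ v ∈ e.support, d v ^ e v = ∏ v ∈ e'.support, d v ^ e' v) ∧
      (∃ hi, ∀ e : Fin m × Fin m →₀ ℕ, e.degree ≤ m → Finsupp.weight μ e ≤ hi))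
    -- B2s
    (hS : ∀ M : Matrix (Fin m × Fin m) (Fin m × Fin m) ℂ,
      (∃ a : Fin 4 → Matrix (Fin n) (Fin n) ℂ,
        (∀ (r : Fin 4) (i j : Fin n), j < i → a r i j = 0) ∧
        (∀ I I' : Fin 4 → Fin n, M (ι I') (ι I) = ∏ r, a r (I' r) (I r)) ∧
        M (0, 0) (0, 0) ^ (m - n) * ∏ r, ∏ i, a r i i = 1) →
      (∀ (I : Fin 4 → Fin n) (p : Fin m × Fin m), p ∉ Set.range ι → M p (ι I) = 0) →
      (∀ p : Fin m × Fin m, p ≠ (0, 0) → M p (0, 0) = 0) →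
      linSubst (Fin m × Fin m) ℂ M
          (X ((0 : Fin m), (0 : Fin m)) ^ (m - n) *
            rename ι (hyperdet fun I : Fin 4 → Fin n => (X I : MvPolynomial (Fin 4 → Fin n) ℂ))) =
        X ((0 : Fin m), (0 : Fin m)) ^ (m - n) *
          rename ι (hyperdet fun I : Fin 4 → Fin n => (X I : MvPolynomial (Fin 4 → Fin n) ℂ)))
    -- B2t
    (hT : ∀ (f : MvPolynomial (Fin m × Fin m) ℂ) (P : ℕ → MvPolynomial (Fin m × Fin m) ℂ),
      (∀ t, P t ∈ glOrbit (Fin m × Fin m) ℂ (detPoly (Fin m) ℂ)) →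
      ∀ J : ℕ → Set (MvPolynomial (Fin m × Fin m) ℂ), IsBorderApolarLimit m P J →
      (∀ k ≤ m, ∀ D ∈ J k, apolarAction D f = 0) →
      ∀ (μ : Fin m × Fin m → ℤ) ν₀, (∀ d ∈ f.support, Finsupp.weight μ d = ν₀) →
      ∃ (P' : ℕ → MvPolynomial (Fin m × Fin m) ℂ) (J' : ℕ → Set (MvPolynomial (Fin m × Fin m) ℂ)),
        (∀ t, P' t ∈ glOrbit (Fin m × Fin m) ℂ (detPoly (Fin m) ℂ)) ∧ IsBorderApolarLimit m P' J' ∧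
        (∀ k ≤ m, ∀ D ∈ J' k, apolarAction D f = 0) ∧
        (∀ k, ∀ D, D ∈ J' k ↔ D ∈ Submodule.span ℂ {D' : MvPolynomial (Fin m × Fin m) ℂ |
            ∃ E ∈ J k, ∃ ν, D' = weightedHomogeneousComponent μ ν E ∧
              ∀ ν', ν' < ν → weightedHomogeneousComponent μ ν' E = 0}))
    -- the witness
    (h : ∃ (P : ℕ → MvPolynomial (Fin m × Fin m) ℂ) (J : ℕ → Set (MvPolynomial (Fin m × Fin m) ℂ)),
      (∀ t, P t ∈ glOrbit (Fin m × Fin m) ℂ (detPoly (Fin m) ℂ)) ∧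
      IsBorderApolarLimit m P J ∧
      (∀ k ≤ m, ∀ D ∈ J k, apolarAction D
        (X ((0 : Fin m), (0 : Fin m)) ^ (m - n) *
          rename ι (hyperdet fun I : Fin 4 → Fin n => (X I : MvPolynomial (Fin 4 → Fin n) ℂ))) = 0)) :
    ∃ (P : ℕ → MvPolynomial (Fin m × Fin m) ℂ) (J : ℕ → Set (MvPolynomial (Fin m × Fin m) ℂ)),
      (∀ t, P t ∈ glOrbit (Fin m × Fin m) ℂ (detPoly (Fin m) ℂ)) ∧
      IsBorderApolarLimit m P J ∧
      (∀ A : Matrix.GeneralLinearGroup (Fin m × Fin m) ℂ,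
        let M : Matrix (Fin m × Fin m) (Fin m × Fin m) ℂ := A;
        (∃ a : Fin 4 → Matrix (Fin n) (Fin n) ℂ,
            (∀ (r : Fin 4) (i j : Fin n), j < i → a r i j = 0) ∧
            (∀ I I' : Fin 4 → Fin n, M (ι I') (ι I) = ∏ r, a r (I' r) (I r)) ∧
            M (0, 0) (0, 0) ^ (m - n) * ∏ r, ∏ i, a r i i = 1) →
        (∀ (I : Fin 4 → Fin n) (p : Fin m × Fin m), p ∉ Set.range ι → M p (ι I) = 0) →
        (∀ p : Fin m × Fin m, p ≠ (0, 0) → M p (0, 0) = 0) →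
        (∀ p q : Fin m × Fin m, p ∉ Set.range ι → p ≠ (0, 0) → q ∉ Set.range ι → q ≠ (0, 0) →
            (p.1 : ℕ) * m + (p.2 : ℕ) < (q.1 : ℕ) * m + (q.2 : ℕ) → M q p = 0) →
        ∀ k ≤ m, ∀ D ∈ J k, linSubst (Fin m × Fin m) ℂ Mᵀ D ∈ J k) ∧
      (∀ k ≤ m, ∀ D ∈ J k, apolarAction D
        (X ((0 : Fin m), (0 : Fin m)) ^ (m - n) *
          rename ι (hyperdet fun I : Fin 4 → Fin n => (X I : MvPolynomial (Fin 4 → Fin n) ℂ))) = 0) := by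
  classical
  set pp : MvPolynomial (Fin m × Fin m) ℂ := X ((0 : Fin m), (0 : Fin m)) ^ (m - n) *
    rename ι (hyperdet fun I : Fin 4 → Fin n => (X I : MvPolynomial (Fin 4 → Fin n) ℂ)) with hpp
  obtain ⟨μ, hμ0, hμinj, hAD1, hAD2, hAD3, hAD4, ⟨ν₀, hμpp⟩, hμ4, hi, hμhi⟩ := hW
  obtain ⟨P₀, J₀, hP₀, hJ₀, hJ₀pp⟩ := h
  -- (1) the torus limit of the given witness is a graded witness
  obtain ⟨P₁, J₁, hP₁, hJ₁, hJ₁pp, hJ₁in⟩ := hT pp P₀ hP₀ J₀ hJ₀ hJ₀pp μ ν₀ hμpp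
  have hgr₁ : ∀ k ≤ m, ∀ D ∈ J₁ k, ∀ ν : ℤ, weightedHomogeneousComponent μ ν D ∈ J₁ k :=
    fun k _ D hD ν => (hJ₁in k _).2 (bfba_initSpan_graded_set μ _ D ((hJ₁in k D).1 hD) ν)
  -- (2) the unipotent class `{V : V unit diagonal, Vᵀ ∈ H}`: lowering, unimodular, `(V⁻¹)ᵀ` fixes `pp`
  have hcls : ∀ V : Matrix (Fin m × Fin m) (Fin m × Fin m) ℂ,
      ((∀ a, V a a = 1) ∧
        (∃ a : Fin 4 → Matrix (Fin n) (Fin n) ℂ,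
          (∀ (r : Fin 4) (i j : Fin n), j < i → a r i j = 0) ∧
          (∀ I I' : Fin 4 → Fin n, Vᵀ (ι I') (ι I) = ∏ r, a r (I' r) (I r)) ∧
          Vᵀ (0, 0) (0, 0) ^ (m - n) * ∏ r, ∏ i, a r i i = 1) ∧
        (∀ (I : Fin 4 → Fin n) (p : Fin m × Fin m), p ∉ Set.range ι → Vᵀ p (ι I) = 0) ∧
        (∀ p : Fin m × Fin m, p ≠ (0, 0) → Vᵀ p (0, 0) = 0) ∧
        (∀ p q : Fin m × Fin m, p ∉ Set.range ι → p ≠ (0, 0) → q ∉ Set.range ι → q ≠ (0, 0) →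
          (p.1 : ℕ) * m + (p.2 : ℕ) < (q.1 : ℕ) * m + (q.2 : ℕ) → Vᵀ q p = 0)) →
      (∀ a, V a a = 1) ∧ (∀ a b, a ≠ b → V a b ≠ 0 → μ a < μ b) ∧ IsUnit V.det ∧
        linSubst (Fin m × Fin m) ℂ (V⁻¹)ᵀ pp = pp := by
    rintro V ⟨hV1, ⟨a, hup, hK, hchar⟩, h2, h3, h4⟩
    have hdir : ∀ a b, a ≠ b → V a b ≠ 0 → μ a < μ b := fun x y hxy hV =>
      bfH_dir ι μ hAD1 hAD2 hAD3 hAD4 Vᵀ a hup hK h2 h3 h4 y x (Ne.symm hxy) hV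
    have hVu : IsUnit V.det := by
      rw [bfH_det_unipotent μ hμinj V hV1 hdir]
      exact isUnit_one
    refine ⟨hV1, hdir, hVu, ?_⟩
    have hfix := bfba_linSubst_inv_linSubst Vᵀ (Matrix.isUnit_det_transpose V hVu) pp
    rwa [hS Vᵀ ⟨a, hup, hK, hchar⟩ h2 h3, ← Matrix.transpose_nonsing_inv] at hfix
  -- the descent over the class ends at a graded witness stable under the class
  obtain ⟨P, J, hP, hJ, hJpp, hgr, hU⟩ := hdbf_descent pp μ hμ0 hi hμhi _
    (fun V hV => (hcls V hV).1) (fun V hV => (hcls V hV).2.1) (fun V hV => (hcls V hV).2.2.1)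
    (fun V hV => (hcls V hV).2.2.2) (fun P J hP hJ hJf => hT pp P hP J hJ hJf μ ν₀ hμpp)
    _ P₁ J₁ hP₁ hJ₁ hJ₁pp hgr₁ le_rfl
  -- (3) W4
  have hJsub : ∀ k ≤ m, ∃ Lk : Submodule ℂ (MvPolynomial (Fin m × Fin m) ℂ),
      (Lk : Set (MvPolynomial (Fin m × Fin m) ℂ)) = J k ∧
        Lk ≤ homogeneousSubmodule (Fin m × Fin m) ℂ k := fun k hk => by
    obtain ⟨Lk, h1, h2, -⟩ := bfba_exists_submodule P hP J hJ k hk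
    exact ⟨Lk, h1, h2⟩
  refine ⟨P, J, hP, hJ, ?_, hJpp⟩
  intro A M ha hb hc hd k hk D hD
  exact bfH_W4 n m ι μ hμinj hAD1 hAD2 hAD3 hAD4 hμ4 J hJsub hgr hU M
    ((Matrix.isUnit_iff_isUnit_det _).1 (Units.isUnit A)) ha hb hc hd k hk D hD

end Summit.ValiantsHypothesis.ValiantsHypothesis.Theorems.DetQPDetqpThesis

end
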